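import Summits.ResolutionOfSingularities.ResolutionOfSingularities.Theorems.PurelyInseparableDim4LoopCRegion
import HarnessLib

/-!
# A BRANCHING in-scope certificate ‖ K: `InCoordinateScope q F` by unit-monomial witnesses MODULO the
# variables already forced, with case splits (cell `res-dim4-pi`, seat res-dim4-p-4 g2, WORD #82 (a))

[OURS · counted 0 · instrument.  A `decide`-able sufficient criterion for the cell's predicate
`PIDim4.InCoordinateScope q F` («every minimal prime of `J_q⁺(F)` through the origin is a coordinate
ideal»), strictly extending the two kernel formats in the tree — `ScopeCover.scopeTermsB` (every
`D^{(α)}F` a term) and `LoopC.scopeCertB` (flat unit-monomial witnesses `D^{(α)}F = x^m · U`, `U(0) ≠ 0`).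
Nothing here is a statement about resolution of singularities in dimension `≥ 4` / characteristic `p`.]

WHY A THIRD FORMAT.  At `(p,q) = (2,2)` the R_OD-global hop 2-cycle S1a-296 (eng-w4 g2, K = B by crit-3 g2 /
crit-4 g2) lives on states such as `A = x₂x₄ + x₂x₃² + x₃x₄³ + x₁²x₂x₄ + x₁x₃x₄³ + x₁²x₃x₄³ + x₁³x₃x₄³`
whose `2`-fold locus through `0` is the coordinate LINE `V(x₂,x₃,x₄)`, but no first partial of `A` is a
unit multiple of a power of `x₂` or of `x₃`: `∂₂A = x₄(1+x₁)² + x₃²` becomes the witness `x₃²` only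
MODULO `x₄` (forced first by `∂₃A = x₄³(1+x₁)³`), and `∂₁B = x₁²x₄²(1+x₃)` of its partner `B` is a unit
times the MIXED monomial `x₁²x₄²`, which forces `x₁ ∈ P` OR `x₄ ∈ P` — a case split.  `scopeCertB` (no
reduction, no branching) therefore cannot certify `A`, `B`.

THE FORMAT (§2): at a forced set `T` (variables known to lie in every prime `P` with `J_q⁺(F) ≤ P ≤ 𝔪₀`),
either every generator `D^{(α)}F` (`0 < |α| < q`) lies in `(x_T)` (`leafB`), or some generator reduces
modulo `(x_T)` to `x^m · U` with `U(0) ≠ 0` (`branchWitnessB`) — then some variable of `x^m` lies in `P`,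
and the checker recurses into `T ∪ {i}` for EVERY `i` with `mᵢ > 0` (`scopeTreeB`, a bounded search; no
witness data needed).  §1 is the reduction `redT` modulo `(x_T)` on term lists; §3 the soundness
`inCoordinateScope_of_scopeTreeB` over `ScopeCover.inCoordinateScope_of_forall_prime`.  The objects
(`Terms`, `evalT`, `hasseL`, `live`, `coeffAt`, `idxLT`, `LoopC.downL`) are res-dim4-p-13's / p-3's / p-8's
kits, cited not restated.
bears_on: LADDER-RESOLUTION:D157-DOOR2 (res-dim4-pi · F4-C scope certificates · WORD #82 (a)).
Supports stmt-ResolutionOfSingularities-16155 (helper).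
-/

set_option linter.dupNamespace false -- mandated namespace of this single-conjunct summit

noncomputable section

open MvPolynomial Finset
open scoped BigOperators

namespace Summit.ResolutionOfSingularities.ResolutionOfSingularities.Theorems.PIDim4

namespace LoopC

open StepKit ScopeCover
open Literature.AlgebraicGeometry.Resolution
open Literature.AlgebraicGeometry.Resolution.CentreBlowup

variable {K : Type} [Field K] [DecidableEq K]

/-! ## §1 Reduction of a term list modulo a set of variables -/

/-- Reduction modulo `(x_i : i ∈ T)`: keep the terms of `T`-degree `0`. [folklore] -/
def redT (T : Finset (Fin 4)) (H : Terms 4 K) : Terms 4 K :=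
  H.filter fun t => decide (∀ i ∈ T, t.1 i = 0)

omit [DecidableEq K] in
/-- Splitting a term list along a Boolean predicate does not change the presented polynomial. [folklore] -/
theorem evalT_filter_add_filter_not (pd : (Fin 4 → ℕ) × K → Bool) (H : Terms 4 K) :
    evalT (H.filter pd) + evalT (H.filter fun t => !pd t) = evalT H := by
  induction H with
  | nil => simp
  | cons t H ih =>
    rw [List.filter_cons, List.filter_cons]
    by_cases h : pd t = true
    · rw [if_pos h, if_neg (by simp [h]), evalT_cons, evalT_cons, add_assoc, ih]
    · rw [if_neg h, if_pos (by simpa using h), evalT_cons, evalT_cons, add_left_comm, ih]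

omit [DecidableEq K] in
/-- The terms of positive `T`-degree present an element of `(x_i : i ∈ T)`. [folklore] -/
theorem evalT_filter_pos_mem_span (T : Finset (Fin 4)) (H : Terms 4 K) :
    evalT (H.filter fun t => !decide (∀ i ∈ T, t.1 i = 0)) ∈
      Ideal.span ((fun i => (X i : MvPolynomial (Fin 4) K)) '' (T : Set (Fin 4))) := by
  classical
  induction H with
  | nil => simp
  | cons t H ih =>
    rw [List.filter_cons]
    split_ifs with h
    · rw [evalT_cons]
      refine Ideal.add_mem _ ?_ ih
      simp only [Bool.not_eq_true', decide_eq_false_iff_not, not_forall] at h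
      obtain ⟨i, hiT, hi⟩ := h
      refine MvPolynomial.mem_ideal_span_X_image.mpr fun m' hm' => ⟨i, Finset.mem_coe.mpr hiT, ?_⟩
      have : m' = expo t.1 := Finset.mem_singleton.mp (support_monomial_subset hm')
      subst this
      exact hi
    · exact ih

omit [DecidableEq K] in
/-- **Reduction transfers membership**: if the variables of `T` lie in an ideal `P` containing `evalT H`,
then `P` contains the reduction `evalT (redT T H)`. [folklore] -/
theorem evalT_redT_mem {T : Finset (Fin 4)} {H : Terms 4 K} {P : Ideal (MvPolynomial (Fin 4) K)}
    (hT : ∀ i ∈ T, (X i : MvPolynomial (Fin 4) K) ∈ P) (hH : evalT H ∈ P) : evalT (redT T H) ∈ P := by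
  have hsplit := evalT_filter_add_filter_not (fun t => decide (∀ i ∈ T, t.1 i = 0)) H
  have hpos : evalT (H.filter fun t => !decide (∀ i ∈ T, t.1 i = 0)) ∈ P := by
    refine (Ideal.span_le.mpr ?_) (evalT_filter_pos_mem_span T H)
    rintro _ ⟨i, hi, rfl⟩
    exact hT i (Finset.mem_coe.mp hi)
  have heq : evalT (redT T H) = evalT H - evalT (H.filter fun t => !decide (∀ i ∈ T, t.1 i = 0)) := by
    rw [← hsplit, redT, add_sub_cancel_right]
  rw [heq]
  exact P.sub_mem hH hpos

/-! ## §2 The branching checker -/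

/-- **Leaf test** at the forced set `T`: every live exponent of every generator `D^{(α)}F`, `0 < |α| < q`,
has positive `T`-degree — so `J_q⁺(F) ≤ (x_T)`. [folklore] -/
def leafB (q : ℕ) (L : Terms 4 K) (T : Finset (Fin 4)) : Bool :=
  decide (∀ α ∈ idxLT q, ∀ e ∈ live (hasseL α L), ∃ i ∈ T, 0 < e i)

/-- **Branching witness** at the forced set `T`: `0 < |α| < q` and, modulo `(x_T)`, the generator
`D^{(α)}F` reduces to `x^m · U` with `U(0) ≠ 0` (every non-zero reduced term divisible by `x^m`, the
coefficient of `x^m` itself non-zero). [folklore] -/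
def branchWitnessB (q : ℕ) (L : Terms 4 K) (T : Finset (Fin 4)) (α m : Fin 4 → ℕ) : Bool :=
  decide (0 < ∑ i, α i) && decide (∑ i, α i < q) &&
    ((redT T (hasseL α L)).all fun t => decide (t.2 = 0) || decide (∀ i, m i ≤ t.1 i)) &&
    !decide (coeffAt (redT T (hasseL α L)) m = 0)

/-- **The branching in-scope checker** (bounded search, `fuel` = remaining depth): at the forced set `T`,
accept at a leaf; otherwise look for a branching witness `(α, m)` among the generators and the exponents
of their reductions, and recurse into `T ∪ {i}` for EVERY variable `x_i` of `x^m`. [folklore] -/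
def scopeTreeB (q : ℕ) (L : Terms 4 K) : ℕ → Finset (Fin 4) → Bool
  | 0, T => leafB q L T
  | fuel + 1, T => leafB q L T ||
      (idxLT q).any fun α => ((redT T (hasseL α L)).map Prod.fst).any fun m =>
        branchWitnessB q L T α m && decide (∀ i, 0 < m i → scopeTreeB q L fuel (insert i T) = true)

/-! ## §3 Soundness -/

/-- Leaf soundness: `J_q⁺(F) ≤ (x_T)`. [folklore] -/
theorem singLocusIdeal_le_span_of_leafB {q : ℕ} {L : Terms 4 K} {T : Finset (Fin 4)}
    (h : leafB q L T = true) :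
    singLocusIdeal q (evalT L) ≤ Ideal.span ((fun i => (X i : MvPolynomial (Fin 4) K)) '' (T : Set (Fin 4))) := by
  classical
  simp only [leafB, decide_eq_true_eq] at h
  unfold singLocusIdeal
  rw [Ideal.span_le]
  rintro G ⟨α, h0, hq, rfl⟩
  rw [SetLike.mem_coe, ← expo_coe α, hasseDeriv_evalT]
  refine MvPolynomial.mem_ideal_span_X_image.mpr fun m' hm' => ?_
  obtain ⟨i, hiT, hi⟩ := h (⇑α) (mem_idxLT h0 hq) (⇑m') ((mem_support_evalT_iff _ m').mp hm')
  exact ⟨i, Finset.mem_coe.mpr hiT, Nat.pos_iff_ne_zero.mp hi⟩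

/-- **A branching witness at `T ⊆ {i | xᵢ ∈ P}` puts a variable of `x^m` into every prime `P` between
`J_q⁺(F)` and `𝔪₀`.** [folklore] -/
theorem exists_X_mem_of_branchWitnessB {q : ℕ} {L : Terms 4 K} {T : Finset (Fin 4)} {α m : Fin 4 → ℕ}
    (hw : branchWitnessB q L T α m = true) {P : Ideal (MvPolynomial (Fin 4) K)} (hP : P.IsPrime)
    (hJP : singLocusIdeal q (evalT L) ≤ P) (hP0 : P ≤ originIdeal K)
    (hT : ∀ i ∈ T, (X i : MvPolynomial (Fin 4) K) ∈ P) :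
    ∃ i, 0 < m i ∧ (X i : MvPolynomial (Fin 4) K) ∈ P := by
  classical
  simp only [branchWitnessB, Bool.and_eq_true, decide_eq_true_eq, List.all_eq_true, Bool.or_eq_true,
    Bool.not_eq_true', decide_eq_false_iff_not] at hw
  obtain ⟨⟨⟨h0, hq⟩, hdiv⟩, hunit⟩ := hw
  set H := redT T (hasseL α L) with hH
  -- the generator `D^{(α)}F ∈ P`, hence its reduction modulo `(x_T)` as well
  have hG : evalT (hasseL α L) ∈ P := by
    refine hJP (Ideal.subset_span ⟨expo α, ?_, ?_, ?_⟩)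
    · rw [degree_expo]; exact h0
    · rw [degree_expo]; exact hq
    · rw [← hasseDeriv_evalT]
  have hR : evalT H ∈ P := evalT_redT_mem hT hG
  rw [evalT_eq_monomial_mul_downL hdiv] at hR
  rcases hP.mem_or_mem hR with hm | hU
  · -- `x^m ∈ P`: some variable of `m` lies in `P`
    have hspan := monomial_mem_span_varsOf hP hP0 hm
    obtain ⟨i, hi, hmi⟩ := MvPolynomial.mem_ideal_span_X_image.mp hspan (expo m)
      (by rw [MvPolynomial.mem_support_iff, coeff_monomial, if_pos rfl]; exact one_ne_zero)
    exact ⟨i, Nat.pos_of_ne_zero hmi, hi⟩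
  · -- the co-factor is a unit at the origin: contradiction
    exfalso
    have hU0 : evalT (downL m H) ∈ originIdeal K := hP0 hU
    rw [IsolationCert.originIdeal_eq_idealOfVars,
      Literature.RingTheory.MvPolynomial.mem_idealOfVars_iff_constantCoeff_eq_zero] at hU0
    apply hunit
    rw [← coeffAt_downL_zero hdiv, ← Finsupp.coe_zero, ← coeff_evalT]
    exact hU0

/-- **Soundness of the search, at every forced set**: for a prime `P` between `J_q⁺(F)` and `𝔪₀` whose
variables include `T`, a passing check at `T` gives `J_q⁺(F) ≤ (xᵢ : xᵢ ∈ P)`. [folklore] -/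
theorem singLocusIdeal_le_of_scopeTreeB {q : ℕ} {L : Terms 4 K} {P : Ideal (MvPolynomial (Fin 4) K)}
    (hP : P.IsPrime) (hJP : singLocusIdeal q (evalT L) ≤ P) (hP0 : P ≤ originIdeal K) :
    ∀ (fuel : ℕ) (T : Finset (Fin 4)), (∀ i ∈ T, (X i : MvPolynomial (Fin 4) K) ∈ P) →
      scopeTreeB q L fuel T = true →
      singLocusIdeal q (evalT L) ≤ Ideal.span ((fun i => (X i : MvPolynomial (Fin 4) K)) '' varsOf P) := by
  classical
  have leaf : ∀ T : Finset (Fin 4), (∀ i ∈ T, (X i : MvPolynomial (Fin 4) K) ∈ P) → leafB q L T = true →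
      singLocusIdeal q (evalT L) ≤ Ideal.span ((fun i => (X i : MvPolynomial (Fin 4) K)) '' varsOf P) := by
    intro T hT h
    refine le_trans (singLocusIdeal_le_span_of_leafB h) (Ideal.span_mono (Set.image_mono fun i hi => ?_))
    exact hT i (Finset.mem_coe.mp hi)
  intro fuel
  induction fuel with
  | zero => intro T hT h; exact leaf T hT h
  | succ fuel ih =>
    intro T hT h
    simp only [scopeTreeB, Bool.or_eq_true, List.any_eq_true, Bool.and_eq_true, decide_eq_true_eq] at h
    rcases h with h | ⟨α, -, m, -, hw, hkids⟩
    · exact leaf T hT h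
    · obtain ⟨i, hi, hXi⟩ := exists_X_mem_of_branchWitnessB hw hP hJP hP0 hT
      refine ih (insert i T) (fun k hk => ?_) (hkids i hi)
      rcases Finset.mem_insert.mp hk with rfl | hk
      · exact hXi
      · exact hT k hk

/-- **Soundness of the branching in-scope checker**: `InCoordinateScope q (evalT L)`. [folklore] -/
theorem inCoordinateScope_of_scopeTreeB {q fuel : ℕ} {L : Terms 4 K} (h : scopeTreeB q L fuel ∅ = true) :
    InCoordinateScope q (evalT L) :=
  inCoordinateScope_of_forall_prime fun P hP hJP hP0 =>
    singLocusIdeal_le_of_scopeTreeB hP hJP hP0 fuel ∅ (fun i hi => absurd hi (by simp)) h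

/-- The same for a presented state. [folklore] -/
theorem inCoordinateScope_toState_of_scopeTreeB {q fuel : ℕ} {s : SData 4 K}
    (h : scopeTreeB q s.L fuel ∅ = true) : InCoordinateScope q s.toState.F :=
  inCoordinateScope_of_scopeTreeB h

end LoopC

end Summit.ResolutionOfSingularities.ResolutionOfSingularities.Theorems.PIDim4

end
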